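import Literature.Algebra.Lie.GlIrreducibleSl2Decomposition
import HarnessLib

/-!
# `f^i ∈ 𝔤𝔩^{(i)}(V(d))`, the semisimple elements `u_i = (ad f)^i e^i`, `h_i = [e^i, f^i]`, and `h_i ∉ 𝔰𝔩₂`: Looijenga–Lunts 1997, Appendix, Lemma (7.2)

Topic `Literature/Algebra/Lie` (namespace `Literature.Algebra.Lie`).  Lane `lit-hodgefound` (Track 2 foundations
library), skeleton seat `lit-hodgefound-skel-1` (generation 47), row **A1-155** of
`run/shared/lean/pub/lit-hodgefound/SKELETON.md`: the second Lemma of Looijenga–Lunts' Appendix, "in the situation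
of the previous lemma" (row A1-154, `GlIrreducibleSl2Decomposition`: `V(d)` = `M` with an `𝔰𝔩₂`-triple `(e, h, f)`
of `𝔤𝔩(M)` and `e` cyclic, `𝔤𝔩^{(i)}(V(d)) = glPart f e i`).  THEOREMS ONLY (no definition, no named fact, no
`sorry`; D-0026 net debt `0`); the `𝔰𝔩₂`-module theory is the tree's `Literature.Algebra.Lie.Sl2ModuleWeights`
(Bourbaki, *Lie* VIII §1); the commutator Lie ring on `𝔤𝔩(M)` is Mathlib's reducible non-instance
`LieRing.ofAssociativeRing`, enabled FILE-LOCALLY as in the whole series.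

## Source, VERBATIM

E. Looijenga, V. A. Lunts, *A Lie algebra attached to a projective variety*, Invent. Math. **129** (1997) 361–412
(held TeX text `paper:arxiv-alg-geom_9604014`), Appendix, p0028 L42–L56:

> "**Lemma.** In the situation of the previous lemma, we have for `i = 0, …, m` that `f^i ∈ 𝔤𝔩^{(i)}(V(d))`.
> Furthermore, `u_i := ad_f^i e^i` resp. `h_i := [e^i, f^i]` is a semisimple element in `𝔤𝔩^{(i)}(V))` resp.
> `𝔞𝔲𝔱(V(d))` which commutes with `h = [e, f]`. For `d ≥ 3` and `2 ≤ i ≤ d`, we have `h_i ∉ 𝔰𝔩₂`.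
> *Proof.* There is an inner automorphism of `𝔰𝔩₂` that sends `e` to `f` and so the first statement follows. For
> the second, regard `V(d)` as the space of homogeneous polynomials of degree `d` in two variables `x, y` and let `e`
> resp. `f` act as `x∂/∂y` resp. `y∂/∂x`. The calculation is then straightforward: `x^k y^l` is an eigen vector of
> `h_i` with eigen value `c_{k,l} := k(k-1)⋯(k-1+d)(l+1)(l+2)⋯(l+d) - (k+1)(k+2)⋯(k+d)l(l-1)⋯(l-1+d)`. We have
> `c_{k,l} = -c_{k,l}` [sic] and so `h_i ∈ 𝔞𝔲𝔱(V(d))`. A simple verification shows that under the given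
> constraints, `h_i` is not proportional to `h` and hence not in `𝔰𝔩₂`. It is clear that `[h, u_i] = 0`. Hence `u_i`
> preserves each eigen space of `h` and so `u_i` is semisimple."

## Rendering (as in A1-153/A1-154)

`V(d)` = a finite-dimensional `K`-space `M` (`char K = 0`), an `𝔰𝔩₂`-triple `t : IsSl2Triple h e f` of `𝔤𝔩(M)`,
`e` cyclic (`Literature.LinearAlgebra.cyclicSubspace e v = ⊤`; §1 shows this is EQUIVALENT to irreducibility),
`d + 1 = dim M`; `𝔤𝔩^{(i)}(V(d)) = glPart f e i`; "`𝔰𝔩₂`" = Mathlib `t.toLieSubalgebra K = Ke + Kf + Kh`;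
`𝔞𝔲𝔱(V(d))` = Mathlib `B.skewAdjointSubmodule` for a form `B` with `e, f` skew; "semisimple element" = Mathlib
`Module.End.IsSemisimple` (indeed diagonalizable, `iSup_eigenspace_eq_top_of_lie_h_eq_zero`).

## Contents (all proved)

* §1 **`eq_top_of_forall_apply_mem_of_cyclicSubspace_eq_top`**: for `e` cyclic, `M` is irreducible under the triple
  (`finrank_ker_le_one_of_cyclicSubspace_eq_top`: `dim Ker e ≤ 1`, against two independent highest weight vectors in a
  splitting) — the converse of A1-154's `exists_cyclicSubspace_eq_top_of_forall_eq`; hence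
  `exists_cyclicSubspace_eq_top_symm`: `f` is cyclic too ("an inner automorphism of `𝔰𝔩₂` that sends `e` to `f`").
* §2 **`glPart_symm : glPart e f i = glPart f e i`** (the `ad e`-string of `f^i` spans `𝔤𝔩^{(i)}`: an irreducible
  submodule of dimension `2i+1`, Lemma (7.1)) and **`pow_f_mem_glPart : f^i ∈ 𝔤𝔩^{(i)}(V(d))`** — the first statement.
* §3 `pow_mem_adDegree`, **`lie_h_ad_pow_apply_pow_self`** (`[h, u_i] = 0`), **`lie_h_lie_pow_pow`** (`[h, h_i] = 0`),
  `ad_pow_apply_pow_self_mem_glPart` (`u_i ∈ 𝔤𝔩^{(i)}`), `isSkewAdjoint_bracket_of_isSelfAdjoint`,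
  **`lie_pow_pow_mem_skewAdjointSubmodule`** (`h_i ∈ 𝔞𝔲𝔱(V(d))`).
* §4 **`iSup_eigenspace_eq_top_of_lie_h_eq_zero`** (an operator on `V(d)` commuting with `h` is diagonalizable: the
  weight spaces are lines) and `isSemisimple_of_lie_h_eq_zero`; **`isSemisimple_ad_pow_apply_pow_self`** (`u_i`),
  **`isSemisimple_lie_pow_pow`** (`h_i`).
* §5 `exists_eq_smul_h_of_mem_toLieSubalgebra` (the centralizer of `h` in `Ke + Kf + Kh` is `Kh`),
  `pow_apply_pow_apply_eq_prod_smul` (the string coefficients `e^m f^{j+m} v₀ = ∏ (j+l+1)(μ-j-l) · f^j v₀`),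
  **`lie_pow_pow_not_mem_toLieSubalgebra`**: `h_i ∉ 𝔰𝔩₂` for `dim M ≥ 4` (`d ≥ 3`), `2 ≤ i < dim M` (`i ≤ d`) —
  evaluating `h_i = c h` on `v₀` and `f v₀` gives `(i+1)(d-i) = d-2`, impossible.

## SCOPE

(a) The eigenvalue formula `c_{k,l}` of the polynomial model is not transcribed (the proof of `h_i ∉ 𝔰𝔩₂` evaluates
`h_i` on the two top weight vectors only; `h_i ∈ 𝔞𝔲𝔱` is proved from the parities of `e^i`, `f^i`, A1-153).
(b) Dynkin's theorems and Theorem (7.3) following the Lemma are out of scope.  (c) Nothing here concerns complex tori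
or the Hodge conjecture.

## References

* [LooijengaLunts1997] E. Looijenga, V. A. Lunts, *A Lie algebra attached to a projective variety*, Invent. Math. 129
  (1997) 361–412; arXiv:alg-geom/9604014. Appendix, second Lemma (7.2), p. 28 L42–L56 of the held TeX text.
* [Bourbaki2008LieGroups79] N. Bourbaki, *Lie Groups and Lie Algebras, Chapters 7–9*, Ch. VIII §1 no. 1–3 — via the
  tree's `Literature.Algebra.Lie.Sl2ModuleWeights`.
-/

namespace Literature.Algebra.Lie

open Module Function Set LieAlgebra LieModule

attribute [local instance 100] LieRing.ofAssociativeRing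

/-! ### §1 `V(d)`: `e` cyclic in an `𝔰𝔩₂`-triple makes `M` irreducible (the converse of "`V(d)` is a monic `K[e]`-module") -/

section Irreducible

variable {K : Type*} [Field K] [CharZero K] {M : Type*} [AddCommGroup M] [Module K M] [FiniteDimensional K M]
  {h e f : Module.End K M}

omit [CharZero K] in
/-- A cyclic endomorphism has kernel of dimension `≤ 1` (`M = K v + e(M)`).
[cite: LooijengaLunts1997, Appendix Lemma (7.1) proof, p. 28 L32–L33 ("V(d) is a monic ℂ[e]-module")] -/
theorem finrank_ker_le_one_of_cyclicSubspace_eq_top {v : M} (hcyc : Literature.LinearAlgebra.cyclicSubspace e v = ⊤) :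
    finrank K (LinearMap.ker e) ≤ 1 := by
  have h1 : (⊤ : Submodule K M) ≤ (K ∙ v) ⊔ LinearMap.range e := by
    rw [← hcyc, Literature.LinearAlgebra.cyclicSubspace_eq_span, Submodule.span_le]
    rintro _ ⟨j, rfl⟩
    rw [SetLike.mem_coe]
    dsimp only
    cases j with
    | zero => rw [pow_zero, Module.End.one_apply]; exact Submodule.mem_sup_left (Submodule.mem_span_singleton_self v)
    | succ j => rw [pow_succ', Module.End.mul_apply]; exact Submodule.mem_sup_right (LinearMap.mem_range_self e _)
  have h2 : finrank K M ≤ 1 + finrank K (LinearMap.range e) := by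
    have h3 := Submodule.finrank_mono h1
    rw [finrank_top] at h3
    refine h3.trans ((Submodule.finrank_add_le_finrank_add_finrank _ _).trans ?_)
    have h4 : finrank K (K ∙ v) ≤ 1 := (finrank_span_le_card ({v} : Set M)).trans (by simp)
    omega
  have h5 := LinearMap.finrank_range_add_finrank_ker e
  omega

/-- **For `e` cyclic, `M` is IRREDUCIBLE under the triple**: a non-zero subspace stable under `e` and `f` is `M` (an
`e, f`-stable supplement — complete reducibility, the tree's `IsSl2Triple.exists_isCompl_of_forall_lie_mem` — would
contain a second highest weight vector, but `dim Ker e ≤ 1`). So "`e` cyclic" and "`M = V(d)` irreducible" are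
equivalent renderings (`exists_cyclicSubspace_eq_top_of_forall_eq` is the converse).
[cite: LooijengaLunts1997, Appendix Lemma (7.1) proof, p. 28 L32–L33] -/
theorem eq_top_of_forall_apply_mem_of_cyclicSubspace_eq_top (t : IsSl2Triple h e f) {v : M}
    (hcyc : Literature.LinearAlgebra.cyclicSubspace e v = ⊤) {N : Submodule K M} (hN0 : N ≠ ⊥)
    (heN : ∀ x ∈ N, e x ∈ N) (hfN : ∀ x ∈ N, f x ∈ N) : N = ⊤ := by
  obtain ⟨N', hc, heN', hfN'⟩ := IsSl2Triple.exists_isCompl_of_forall_lie_mem (k := K) (M := M) t (N := N)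
    (fun x hx ↦ heN x hx) (fun x hx ↦ hfN x hx)
  by_contra hne
  have hN'0 : N' ≠ ⊥ := fun h0 ↦ hne (by rw [← hc.sup_eq_top, h0, sup_bot_eq])
  obtain ⟨n₁, v₁, hv₁N, P₁⟩ := IsSl2Triple.exists_hasPrimitiveVectorWith_mem (k := K) (M := M) t hN0
    (fun x hx ↦ heN x hx) (fun x hx ↦ hfN x hx)
  obtain ⟨n₂, v₂, hv₂N', P₂⟩ := IsSl2Triple.exists_hasPrimitiveVectorWith_mem (k := K) (M := M) t hN'0 heN' hfN'
  have hk1 : v₁ ∈ LinearMap.ker e := by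
    have h1 := P₁.lie_e
    rwa [Module.End.lie_apply] at h1
  have hk2 : v₂ ∈ LinearMap.ker e := by
    have h1 := P₂.lie_e
    rwa [Module.End.lie_apply] at h1
  have hker : LinearMap.ker e = K ∙ v₁ := by
    refine (Submodule.eq_of_le_of_finrank_le ((Submodule.span_singleton_le_iff_mem _ _).2 hk1) ?_).symm
    rw [finrank_span_singleton P₁.ne_zero]
    exact finrank_ker_le_one_of_cyclicSubspace_eq_top hcyc
  rw [hker] at hk2
  obtain ⟨c, hc2⟩ := Submodule.mem_span_singleton.1 hk2
  have h3 : v₂ ∈ N ⊓ N' := Submodule.mem_inf.2 ⟨by rw [← hc2]; exact N.smul_mem c hv₁N, hv₂N'⟩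
  rw [hc.inf_eq_bot, Submodule.mem_bot] at h3
  exact P₂.ne_zero h3

/-- … hence **`f` is cyclic too** ("There is an inner automorphism of `𝔰𝔩₂` that sends `e` to `f`": the triple
`(f, -h, e)`, Mathlib `IsSl2Triple.symm`, acts irreducibly as well). [cite: LooijengaLunts1997, Appendix Lemma (7.2) proof, p. 28 L46–L47] -/
theorem exists_cyclicSubspace_eq_top_symm [Nontrivial M] (t : IsSl2Triple h e f) {v : M}
    (hcyc : Literature.LinearAlgebra.cyclicSubspace e v = ⊤) : ∃ w : M, Literature.LinearAlgebra.cyclicSubspace f w = ⊤ :=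
  exists_cyclicSubspace_eq_top_of_forall_eq t.symm fun _ hN hfN heN ↦
    eq_top_of_forall_apply_mem_of_cyclicSubspace_eq_top t hcyc hN heN hfN

end Irreducible

/-! ### §2 "`f^i ∈ 𝔤𝔩^{(i)}(V(d))`" -/

section Symmetry

variable {K : Type*} [Field K] [CharZero K] {M : Type*} [AddCommGroup M] [Module K M] [FiniteDimensional K M]
  {h e f : Module.End K M}

/-- **The `𝔰𝔩₂`-submodule generated by `f^i` is `𝔤𝔩^{(i)}(V(d))`** ("There is an inner automorphism of `𝔰𝔩₂` that
sends `e` to `f` and so the first statement follows": the string of `f^i` under `ad e` is an irreducible submodule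
of dimension `2i + 1`, hence — Lemma (7.1) — equal to `𝔤𝔩^{(i)}`). [cite: LooijengaLunts1997, Appendix Lemma (7.2), p. 28 L43–L47] -/
theorem glPart_symm [Nontrivial M] (t : IsSl2Triple h e f) {v : M}
    (hcyc : Literature.LinearAlgebra.cyclicSubspace e v = ⊤) (i : ℕ) : glPart e f i = glPart f e i := by
  obtain ⟨w, hcycf⟩ := exists_cyclicSubspace_eq_top_symm t hcyc
  by_cases hi : i < finrank K M
  · have hei : e ^ i ≠ 0 := pow_ne_zero_of_lt_finrank hcyc hi
    have hfi : f ^ i ≠ 0 := pow_ne_zero_of_lt_finrank hcycf hi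
    -- `glPart e f i` (the `ad e`-string of `f^i`) is a non-zero irreducible `ad e, ad f`-stable subspace …
    have hN0 : glPart e f i ≠ ⊥ := fun h0 ↦ hfi ((Submodule.mem_bot K).1 (h0 ▸ pow_mem_glPart e f i))
    obtain ⟨j, -, hj, hdim⟩ := exists_eq_glPart_of_forall_eq t hcyc hN0 (fun x hx ↦ lie_f_mem_glPart e f hx)
      (fun x hx ↦ lie_e_mem_glPart t.symm hx)
      (fun N' hN' hN'0 heN' hfN' ↦ eq_glPart_of_le t.symm hfi hN' hN'0 hfN' heN')
    -- … of dimension `2i + 1 = 2j + 1`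
    rw [finrank_glPart t.symm hfi] at hdim
    have hij : i = j := by omega
    rw [hj, hij]
  · rw [not_lt] at hi
    rw [glPart_eq_bot_of_pow_eq_zero (pow_eq_zero_of_finrank_le t hi),
      glPart_eq_bot_of_pow_eq_zero (pow_eq_zero_of_finrank_le t.symm hi)]

/-- **LEMMA (7.2), first statement: "we have for `i = 0, …, m` that `f^i ∈ 𝔤𝔩^{(i)}(V(d))`"** (and `f^i = 0` beyond).
[cite: LooijengaLunts1997, Appendix Lemma (7.2), p. 28 L43–L44] -/
theorem pow_f_mem_glPart [Nontrivial M] (t : IsSl2Triple h e f) {v : M}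
    (hcyc : Literature.LinearAlgebra.cyclicSubspace e v = ⊤) (i : ℕ) : f ^ i ∈ glPart f e i := by
  rw [← glPart_symm t hcyc i]
  exact pow_mem_glPart e f i

/-- … together with its whole `ad e`-string `(ad e)^j f^i`. [cite: LooijengaLunts1997, Appendix Lemma (7.2), p. 28 L43–L44] -/
theorem ad_pow_apply_pow_f_mem_glPart [Nontrivial M] (t : IsSl2Triple h e f) {v : M}
    (hcyc : Literature.LinearAlgebra.cyclicSubspace e v = ⊤) (i j : ℕ) :
    ((LieAlgebra.ad K (Module.End K M) e) ^ j) (f ^ i) ∈ glPart f e i := by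
  rw [← glPart_symm t hcyc i]
  exact ad_pow_apply_pow_mem_glPart e f i j

end Symmetry

/-! ### §3 `u_i = (ad f)^i e^i` and `h_i = [e^i, f^i]` commute with `h`; `h_i ∈ 𝔞𝔲𝔱(V(d))` -/

section Commute

variable {K : Type*} [Field K] [CharZero K] {M : Type*} [AddCommGroup M] [Module K M] [FiniteDimensional K M]
  {h e f : Module.End K M}

omit [CharZero K] [FiniteDimensional K M] in
/-- Powers of a homogeneous operator are homogeneous: `x ∈ 𝔤𝔩_a ⟹ x^i ∈ 𝔤𝔩_{ia}`.
[cite: LooijengaLunts1997, Appendix Lemma (7.1) proof, p. 28 L35 ("[h, e^i] = 2i e^i")] -/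
theorem pow_mem_adDegree {x : Module.End K M} {a : K} (hx : x ∈ adDegree K h a) (i : ℕ) :
    x ^ i ∈ adDegree K h ((i : K) * a) := by
  induction i with
  | zero =>
    rw [pow_zero, Nat.cast_zero, zero_mul, mem_adDegree_iff, Ring.lie_def, mul_one, one_mul, sub_self, zero_smul]
  | succ i ih =>
    rw [pow_succ, Nat.cast_succ, add_mul, one_mul]
    exact mul_mem_adDegree ih hx

omit [CharZero K] [FiniteDimensional K M] in
/-- **"`u_i := (ad f)^i e^i` … commutes with `h = [e, f]`"** ("It is clear that `[h, u_i] = 0`": `u_i` has weight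
`2i - 2i = 0`). [cite: LooijengaLunts1997, Appendix Lemma (7.2), p. 28 L44–L45, L55] -/
theorem lie_h_ad_pow_apply_pow_self (t : IsSl2Triple h e f) (i : ℕ) :
    ⁅h, ((LieAlgebra.ad K (Module.End K M) f) ^ i) (e ^ i)⁆ = 0 := by
  by_cases hi : e ^ i = 0
  · rw [hi, map_zero, lie_zero]
  · rw [lie_h_ad_pow_apply_pow t hi i, sub_self, zero_smul]

omit [CharZero K] [FiniteDimensional K M] in
/-- **"`h_i := [e^i, f^i]` … commutes with `h`"**: `e^i ∈ 𝔤𝔩_{2i}`, `f^i ∈ 𝔤𝔩_{-2i}`, so `[e^i, f^i] ∈ 𝔤𝔩_0`.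
[cite: LooijengaLunts1997, Appendix Lemma (7.2), p. 28 L44–L45] -/
theorem lie_h_lie_pow_pow (t : IsSl2Triple h e f) (i : ℕ) : ⁅h, ⁅e ^ i, f ^ i⁆⁆ = 0 := by
  have h1 := lie_mem_adDegree (pow_mem_adDegree (e_mem_adDegree t) i) (pow_mem_adDegree (f_mem_adDegree t) i)
  rw [mem_adDegree_iff] at h1
  rw [h1, show (i : K) * 2 + (i : K) * (-2) = 0 by ring, zero_smul]

omit [CharZero K] [FiniteDimensional K M] in
/-- `u_i ∈ 𝔤𝔩^{(i)}(V(d))` (it is a member of the string of `e^i`). [cite: LooijengaLunts1997, Appendix Lemma (7.2), p. 28 L44] -/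
theorem ad_pow_apply_pow_self_mem_glPart (f e : Module.End K M) (i : ℕ) :
    ((LieAlgebra.ad K (Module.End K M) f) ^ i) (e ^ i) ∈ glPart f e i :=
  ad_pow_apply_pow_mem_glPart f e i i

variable {B : LinearMap.BilinForm K M}

omit [CharZero K] [FiniteDimensional K M] in
/-- The commutator of two SELF-adjoint operators is skew-adjoint (as is that of two skew-adjoint ones, Mathlib
`LinearMap.BilinForm.isSkewAdjoint_bracket`). [cite: LooijengaLunts1997, Appendix Lemma (7.2) proof, p. 28 L52–L53 ("and so h_i ∈ 𝔞𝔲𝔱(V(d))")] -/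
theorem isSkewAdjoint_bracket_of_isSelfAdjoint {x y : Module.End K M} (hx : B.IsSelfAdjoint x)
    (hy : B.IsSelfAdjoint y) : B.IsSkewAdjoint ⇑⁅x, y⁆ := by
  have hxy : LinearMap.IsAdjointPair B B (x * y) (y * x) := hy.comp hx
  have hyx : LinearMap.IsAdjointPair B B (y * x) (x * y) := hx.comp hy
  change LinearMap.IsAdjointPair B B ⇑(x * y - y * x) ⇑(-(x * y - y * x))
  rw [neg_sub]
  exact hxy.sub hyx

omit [CharZero K] [FiniteDimensional K M] in
/-- **"`h_i ∈ 𝔞𝔲𝔱(V(d))`"**: for `e, f` skew, `e^i` and `f^i` are both skew (`i` odd) or both self-adjoint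
(`i` even), so `h_i = [e^i, f^i]` is skew. [cite: LooijengaLunts1997, Appendix Lemma (7.2), p. 28 L44–L45, L52–L53] -/
theorem lie_pow_pow_mem_skewAdjointSubmodule (he : B.IsSkewAdjoint e) (hf : B.IsSkewAdjoint f) (i : ℕ) :
    ⁅e ^ i, f ^ i⁆ ∈ B.skewAdjointSubmodule := by
  rcases Nat.even_or_odd i with hev | hodd
  · exact (LinearMap.mem_skewAdjointSubmodule _).2
      (isSkewAdjoint_bracket_of_isSelfAdjoint (isSelfAdjoint_pow_of_even he hev) (isSelfAdjoint_pow_of_even hf hev))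
  · exact B.isSkewAdjoint_bracket ((LinearMap.mem_skewAdjointSubmodule _).2 (isSkewAdjoint_pow_of_odd he hodd))
      ((LinearMap.mem_skewAdjointSubmodule _).2 (isSkewAdjoint_pow_of_odd hf hodd))

end Commute

/-! ### §4 "Hence `u_i` preserves each eigen space of `h` and so `u_i` is semisimple" -/

section Semisimple

variable {K : Type*} [Field K] [CharZero K] {M : Type*} [AddCommGroup M] [Module K M] [FiniteDimensional K M]
  {h e f : Module.End K M}

omit [CharZero K] in
/-- A finite-dimensional endomorphism whose eigenspaces span the space is semisimple (it is annihilated by the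
separable polynomial `∏_{μ eigenvalue} (X − μ)`). [folklore] -/
private theorem isSemisimple_of_iSup_eigenspace_eq_top' {g : Module.End K M} (hg : ⨆ μ : K, g.eigenspace μ = ⊤) :
    g.IsSemisimple := by
  classical
  set S : Finset K := (Module.End.finite_hasEigenvalue g).toFinset with hS
  set P : Polynomial K := ∏ μ ∈ S, (Polynomial.X - Polynomial.C μ) with hP
  have hsep : P.Separable := Polynomial.separable_prod_X_sub_C_iff'.2 fun x _ y _ hxy ↦ hxy
  refine Module.End.isSemisimple_of_squarefree_aeval_eq_zero hsep.squarefree ?_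
  ext v
  rw [LinearMap.zero_apply]
  have hv : v ∈ ⨆ μ : K, g.eigenspace μ := by rw [hg]; exact Submodule.mem_top
  refine Submodule.iSup_induction _ (motive := fun v ↦ Polynomial.aeval g P v = 0) hv (fun μ v hv ↦ ?_)
    (map_zero _) fun x y hx hy ↦ by rw [map_add, hx, hy, add_zero]
  by_cases hv0 : v = 0
  · rw [hv0, map_zero]
  have hev : g.HasEigenvector μ v := ⟨hv, hv0⟩
  have hμ : μ ∈ S := by
    rw [hS, Set.Finite.mem_toFinset]; exact Module.End.hasEigenvalue_of_hasEigenvector hev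
  rw [Module.End.aeval_apply_of_hasEigenvector hev, hP, Polynomial.eval_prod,
    Finset.prod_eq_zero hμ (by simp), zero_smul]

/-- **An operator on `V(d)` commuting with `h` is diagonalizable** ("`u_i` preserves each eigen space of `h` and so
`u_i` is semisimple": the weight spaces of `V(d)` are the lines `K f^j v₀` of the string of a highest weight vector
`v₀` — the tree's `exists_mem_span_singleton_of_lie_h_eq`, Bourbaki VIII §1 Prop. 2 (iii) — so each `f^j v₀` is an
eigenvector). [cite: LooijengaLunts1997, Appendix Lemma (7.2) proof, p. 28 L55–L56] -/
theorem iSup_eigenspace_eq_top_of_lie_h_eq_zero [Nontrivial M] (t : IsSl2Triple h e f) {v : M}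
    (hcyc : Literature.LinearAlgebra.cyclicSubspace e v = ⊤) {T : Module.End K M} (hT : ⁅h, T⁆ = 0) :
    ⨆ μ : K, T.eigenspace μ = ⊤ := by
  obtain ⟨v₀, n, P, hspan, -⟩ := IsSl2Triple.exists_hasPrimitiveVectorWith_span_eq_top (k := K) (M := M) t
    fun N hN heN hfN ↦ eq_top_of_forall_apply_mem_of_cyclicSubspace_eq_top t hcyc hN
      (fun x hx ↦ heN x hx) (fun x hx ↦ hfN x hx)
  have hTh : ∀ x : M, h (T x) = T (h x) := fun x ↦ by
    rw [Ring.lie_def, sub_eq_zero] at hT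
    rw [← Module.End.mul_apply, hT, Module.End.mul_apply]
  -- every member `f^j v₀` of the string is an eigenvector of `T`
  have hmem : ∀ j : ℕ, (LieModule.toEnd K (Module.End K M) M f ^ j) v₀ ∈ ⨆ μ : K, T.eigenspace μ := by
    intro j
    by_cases hj : n < j
    · rw [IsSl2Triple.HasPrimitiveVectorWith.pow_toEnd_f_eq_zero_of_lt P hj]
      exact Submodule.zero_mem _
    rw [not_lt] at hj
    set w := (LieModule.toEnd K (Module.End K M) M f ^ j) v₀ with hw
    have hw1 : ⁅h, w⁆ = ((n : K) - 2 * j) • w := P.lie_h_pow_toEnd_f j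
    by_cases hTw : T w = 0
    · exact Submodule.mem_iSup_of_mem 0 (Module.End.mem_eigenspace_iff.2 (by rw [hTw, zero_smul]))
    · -- `T w` is a non-zero `h`-eigenvector of the same weight inside the string module, hence a multiple of `w`
      have hTw1 : ⁅h, T w⁆ = ((n : K) - 2 * j) • T w := by
        rw [Module.End.lie_apply] at hw1 ⊢
        rw [hTh, hw1, map_smul]
      have hTwM : T w ∈ Submodule.span K (Set.range fun j : ℕ ↦ (LieModule.toEnd K (Module.End K M) M f ^ j) v₀) := by
        rw [hspan]; exact Submodule.mem_top
      obtain ⟨j', -, hμ, hTw2⟩ := IsSl2Triple.HasPrimitiveVectorWith.exists_mem_span_singleton_of_lie_h_eq P hTwM hTw hTw1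
      have hjj : j' = j := by
        have h2 : (2 : K) * j' = 2 * j := by linear_combination hμ
        exact_mod_cast mul_left_cancel₀ (two_ne_zero (α := K)) h2
      rw [hjj] at hTw2
      obtain ⟨c, hc⟩ := Submodule.mem_span_singleton.1 hTw2
      exact Submodule.mem_iSup_of_mem c (Module.End.mem_eigenspace_iff.2 hc.symm)
  refine top_unique (hspan.ge.trans (Submodule.span_le.2 ?_))
  rintro _ ⟨j, rfl⟩
  exact hmem j

/-- … hence **semisimple**. [cite: LooijengaLunts1997, Appendix Lemma (7.2) proof, p. 28 L55–L56] -/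
theorem isSemisimple_of_lie_h_eq_zero [Nontrivial M] (t : IsSl2Triple h e f) {v : M}
    (hcyc : Literature.LinearAlgebra.cyclicSubspace e v = ⊤) {T : Module.End K M} (hT : ⁅h, T⁆ = 0) : T.IsSemisimple :=
  isSemisimple_of_iSup_eigenspace_eq_top' (iSup_eigenspace_eq_top_of_lie_h_eq_zero t hcyc hT)

/-- **LEMMA (7.2): "`u_i := (ad f)^i e^i` … is a semisimple element … which commutes with `h`"**.
[cite: LooijengaLunts1997, Appendix Lemma (7.2), p. 28 L44–L45, L55–L56] -/
theorem isSemisimple_ad_pow_apply_pow_self [Nontrivial M] (t : IsSl2Triple h e f) {v : M}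
    (hcyc : Literature.LinearAlgebra.cyclicSubspace e v = ⊤) (i : ℕ) :
    (((LieAlgebra.ad K (Module.End K M) f) ^ i) (e ^ i)).IsSemisimple :=
  isSemisimple_of_lie_h_eq_zero t hcyc (lie_h_ad_pow_apply_pow_self t i)

/-- **LEMMA (7.2): "`h_i := [e^i, f^i]` is a semisimple element in `𝔞𝔲𝔱(V(d))` which commutes with `h`"** (the
semisimplicity; membership in `𝔞𝔲𝔱` is `lie_pow_pow_mem_skewAdjointSubmodule`).
[cite: LooijengaLunts1997, Appendix Lemma (7.2), p. 28 L44–L45, L50–L53] -/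
theorem isSemisimple_lie_pow_pow [Nontrivial M] (t : IsSl2Triple h e f) {v : M}
    (hcyc : Literature.LinearAlgebra.cyclicSubspace e v = ⊤) (i : ℕ) : (⁅e ^ i, f ^ i⁆ : Module.End K M).IsSemisimple :=
  isSemisimple_of_lie_h_eq_zero t hcyc (lie_h_lie_pow_pow t i)

end Semisimple

/-! ### §5 "For `d ≥ 3` and `2 ≤ i ≤ d`, we have `h_i ∉ 𝔰𝔩₂`" -/

section NotInSl2

variable {K : Type*} [Field K] [CharZero K]

/-- **The centralizer of `h` in `Ke + Kf + Kh` is the line `Kh`**: an element of the subalgebra of an `𝔰𝔩₂`-triple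
commuting with `h` is proportional to `h` (its components along `e ∈ 𝔤₂` and `f ∈ 𝔤₋₂` vanish; the tree's
`mem_adDegree_zero_iff_of_isSl2Triple` is the same statement when the triple spans the whole Lie algebra) — "`h_i` is
not proportional to `h` and hence not in `𝔰𝔩₂`". [cite: LooijengaLunts1997, Appendix Lemma (7.2) proof, p. 28 L53–L55; §2 (2.2)] -/
theorem exists_eq_smul_h_of_mem_toLieSubalgebra {L : Type*} [LieRing L] [LieAlgebra K L] {h e f : L}
    (t : IsSl2Triple h e f) {x : L} (hx : x ∈ t.toLieSubalgebra K) (h0 : ⁅h, x⁆ = 0) : ∃ c : K, x = c • h := by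
  obtain ⟨a, b, c, rfl⟩ := IsSl2Triple.mem_toLieSubalgebra_iff.1 hx
  rw [t.lie_e_f] at h0 ⊢
  have h1 : ⁅h, a • e + b • f + c • h⁆ = (2 : K) • (a • e) - (2 : K) • (b • f) := by
    rw [lie_add, lie_add, lie_smul, lie_smul, lie_smul, lie_self, smul_zero, add_zero, t.lie_h_e_smul K,
      t.lie_lie_smul_f K, smul_neg, smul_comm a (2 : K) e, smul_comm b (2 : K) f, sub_eq_add_neg]
  rw [h1, sub_eq_zero] at h0
  have h2 : a • e = b • f := smul_right_injective L (two_ne_zero (α := K)) h0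
  -- `a • e = b • f` has `h`-weight `2` and `-2`, hence vanishes
  have h3 : ⁅h, a • e⁆ = (2 : K) • (a • e) := by rw [lie_smul, t.lie_h_e_smul K, smul_comm]
  have h4 : ⁅h, a • e⁆ = -((2 : K) • (a • e)) := by rw [h2, lie_smul, t.lie_lie_smul_f K, smul_neg, smul_comm]
  have h5 : a • e = 0 := by
    have h6 : ((2 : K) + 2) • (a • e) = 0 := by
      rw [add_smul]
      nth_rw 1 [← h3]
      rw [h4, neg_add_cancel]
    exact (smul_eq_zero.1 h6).resolve_left (by norm_num)
  have ha : a = 0 := (smul_eq_zero.1 h5).resolve_right t.e_ne_zero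
  have hb : b = 0 := by
    rw [h2] at h5
    exact (smul_eq_zero.1 h5).resolve_right t.f_ne_zero
  exact ⟨c, by rw [ha, hb, zero_smul, zero_smul, zero_add, zero_add]⟩

variable {M : Type*} [AddCommGroup M] [Module K M] [FiniteDimensional K M] {h e f : Module.End K M}

omit [CharZero K] [FiniteDimensional K M] in
/-- **The string coefficients**: for a highest weight vector `v₀` of weight `μ` (triple of `𝔤𝔩(M)` acting on `M`),
`e^m f^{j+m} v₀ = (∏_{l<m} (j+l+1)(μ-j-l)) f^j v₀` (iterating Mathlib's `lie_e_pow_succ_toEnd_f`; the polynomial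
model "`x^k y^l`, `e = x∂/∂y`, `f = y∂/∂x`" of the printed proof). [cite: LooijengaLunts1997, Appendix Lemma (7.2) proof, p. 28 L47–L52] -/
theorem pow_apply_pow_apply_eq_prod_smul (t : IsSl2Triple h e f) {v₀ : M} {μ : K} (P : t.HasPrimitiveVectorWith v₀ μ)
    (j m : ℕ) : (e ^ m) ((f ^ (j + m)) v₀) =
      (∏ l ∈ Finset.range m, ((((j + l : ℕ) : K) + 1) * (μ - ((j + l : ℕ) : K)))) • (f ^ j) v₀ := by
  induction m with
  | zero => rw [pow_zero, Module.End.one_apply, add_zero, Finset.prod_range_zero, one_smul]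
  | succ m ih =>
    have h1 := P.lie_e_pow_succ_toEnd_f (j + m)
    simp only [LieModule.toEnd_module_end, LieHom.id_apply, Module.End.lie_apply] at h1
    rw [pow_succ, Module.End.mul_apply, ← add_assoc, h1, map_smul, ih, smul_smul]
    congr 1
    rw [Finset.prod_range_succ]
    ring

/-- **LEMMA (7.2), last statement: "For `d ≥ 3` and `2 ≤ i ≤ d`, we have `h_i ∉ 𝔰𝔩₂`"** — `h_i = [e^i, f^i]` does not lie
in the image `Ke + Kf + Kh` of `𝔰𝔩₂` (`d + 1 = dim M ≥ 4`, `2 ≤ i ≤ d`). Printed proof, followed: `h_i` commutes with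
`h`, so if it were in `𝔰𝔩₂` it would be `c h`; "a simple verification shows that under the given constraints, `h_i` is
not proportional to `h`": on the highest weight vector `v₀` (weight `d`) `h_i v₀ = e^i f^i v₀ = d·Q v₀` and on `f v₀`
(weight `d - 2`) `h_i f v₀ = e^i f^{i+1} v₀ = Q·(i+1)(d-i) f v₀` with `Q = ∏_{1≤l<i} (l+1)(d-l) ≠ 0`, and
`(i+1)(d-i) ≠ d - 2` for `2 ≤ i ≤ d`, `d ≥ 3`. [cite: LooijengaLunts1997, Appendix Lemma (7.2), p. 28 L45–L46, L47–L55] -/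
theorem lie_pow_pow_not_mem_toLieSubalgebra [Nontrivial M] (t : IsSl2Triple h e f) {v : M}
    (hcyc : Literature.LinearAlgebra.cyclicSubspace e v = ⊤) (hd : 4 ≤ finrank K M) {i : ℕ} (hi2 : 2 ≤ i)
    (hid : i < finrank K M) : ⁅e ^ i, f ^ i⁆ ∉ t.toLieSubalgebra K := by
  intro hmem
  obtain ⟨c, hc⟩ := exists_eq_smul_h_of_mem_toLieSubalgebra t hmem (lie_h_lie_pow_pow t i)
  -- a highest weight vector `v₀`, of weight `n = d`, whose string spans `M`
  obtain ⟨v₀, n, P, hspan, hfin⟩ := IsSl2Triple.exists_hasPrimitiveVectorWith_span_eq_top (k := K) (M := M) t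
    fun N hN heN hfN ↦ eq_top_of_forall_apply_mem_of_cyclicSubspace_eq_top t hcyc hN
      (fun x hx ↦ heN x hx) (fun x hx ↦ hfN x hx)
  have hn3 : 3 ≤ n := by omega
  have hin : i ≤ n := by omega
  obtain ⟨i₀, rfl⟩ : ∃ i₀, i = i₀ + 1 := ⟨i - 1, by omega⟩
  -- basic values on `v₀` and `f v₀`
  have heV : e v₀ = 0 := by have h1 := P.lie_e; rwa [Module.End.lie_apply] at h1
  have hhV : h v₀ = (n : K) • v₀ := by have h1 := P.lie_h; rwa [Module.End.lie_apply] at h1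
  have hhfV : h (f v₀) = ((n : K) - 2) • f v₀ := by
    have h1 := P.lie_h_pow_toEnd_f 1
    simp only [LieModule.toEnd_module_end, LieHom.id_apply, Module.End.lie_apply, pow_one, Nat.cast_one,
      mul_one] at h1
    exact h1
  have hfV : f v₀ ≠ 0 := by
    have h1 := P.pow_toEnd_f_ne_zero_of_eq_nat (n := n) rfl (by omega : 1 ≤ n)
    simp only [LieModule.toEnd_module_end, LieHom.id_apply, pow_one] at h1
    exact h1
  -- the string coefficients `g l = (l+1)(n-l)`
  set g : ℕ → K := fun l ↦ ((l : K) + 1) * ((n : K) - l) with hg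
  have hp : (e ^ (i₀ + 1)) ((f ^ (i₀ + 1)) v₀) = ((∏ l ∈ Finset.range i₀, g (l + 1)) * g 0) • v₀ := by
    have h1 := pow_apply_pow_apply_eq_prod_smul t P 0 (i₀ + 1)
    rw [zero_add, pow_zero, Module.End.one_apply] at h1
    rw [h1, ← Finset.prod_range_succ' (fun l ↦ g l) i₀]
    congr 1
    exact Finset.prod_congr rfl fun l _ ↦ by rw [hg]; push_cast; ring
  have hr : (e ^ (i₀ + 1)) ((f ^ (i₀ + 1)) (f v₀)) = ((∏ l ∈ Finset.range i₀, g (l + 1)) * g (i₀ + 1)) • f v₀ := by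
    have h1 := pow_apply_pow_apply_eq_prod_smul t P 1 (i₀ + 1)
    rw [pow_one] at h1
    rw [← Module.End.mul_apply (f ^ (i₀ + 1)) f, ← pow_succ, show i₀ + 1 + 1 = 1 + (i₀ + 1) by ring, h1,
      ← Finset.prod_range_succ (fun l ↦ g (l + 1)) i₀]
    congr 1
    exact Finset.prod_congr rfl fun l _ ↦ by rw [hg]; push_cast; ring
  -- `f^i e^i v₀ = 0` and, as `i ≥ 2`, `f^i e^i (f v₀) = 0` (`e f v₀ = n v₀`, `e² f v₀ = 0`)
  have he1 : (e ^ (i₀ + 1)) v₀ = 0 := by rw [pow_succ, Module.End.mul_apply, heV, map_zero]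
  have he2 : (e ^ (i₀ + 1)) (f v₀) = 0 := by
    have h1 := pow_apply_pow_apply_eq_prod_smul t P 0 1
    rw [zero_add, pow_one, pow_zero, Module.End.one_apply, pow_one] at h1
    obtain ⟨i₁, rfl⟩ : ∃ i₁, i₀ = i₁ + 1 := ⟨i₀ - 1, by omega⟩
    rw [pow_succ, Module.End.mul_apply, h1, map_smul, pow_succ, Module.End.mul_apply, heV, map_zero, smul_zero]
  -- `h_i v₀ = c h v₀` and `h_i (f v₀) = c h (f v₀)`
  have hv₀ := LinearMap.congr_fun hc v₀
  have hv₁ := LinearMap.congr_fun hc (f v₀)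
  rw [Ring.lie_def, LinearMap.sub_apply, Module.End.mul_apply, Module.End.mul_apply, hp, he1, map_zero, sub_zero,
    LinearMap.smul_apply, hhV, smul_smul] at hv₀
  rw [Ring.lie_def, LinearMap.sub_apply, Module.End.mul_apply, Module.End.mul_apply, hr, he2, map_zero, sub_zero,
    LinearMap.smul_apply, hhfV, smul_smul] at hv₁
  have hQ : ∏ l ∈ Finset.range i₀, g (l + 1) ≠ 0 := by
    refine Finset.prod_ne_zero_iff.2 fun l hl ↦ mul_ne_zero ?_ (sub_ne_zero.2 ?_)
    · push_cast
      exact_mod_cast (Nat.succ_ne_zero (l + 1))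
    · rw [Finset.mem_range] at hl
      push_cast
      exact_mod_cast (show (n : ℤ) ≠ (l : ℤ) + 1 by omega)
  have hg0 : g 0 = (n : K) := by rw [hg]; dsimp only; rw [Nat.cast_zero, zero_add, one_mul, sub_zero]
  have e1 : (∏ l ∈ Finset.range i₀, g (l + 1)) * g 0 = c * n := smul_left_injective K P.ne_zero hv₀
  have e2 : (∏ l ∈ Finset.range i₀, g (l + 1)) * g (i₀ + 1) = c * ((n : K) - 2) := smul_left_injective K hfV hv₁
  rw [hg0] at e1
  have hcQ : c = ∏ l ∈ Finset.range i₀, g (l + 1) :=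
    (mul_right_cancel₀ (by exact_mod_cast (show n ≠ 0 by omega) : (n : K) ≠ 0) e1).symm
  rw [hcQ] at e2
  have e3 : g (i₀ + 1) = (n : K) - 2 := mul_left_cancel₀ hQ e2
  rw [hg] at e3
  dsimp only at e3
  -- `(i + 1)(n - i) = n - 2` is impossible for `2 ≤ i ≤ n`, `n ≥ 3`
  have e4 : (((i₀ + 1 : ℕ) : ℤ) + 1) * ((n : ℤ) - ((i₀ + 1 : ℕ) : ℤ)) = (n : ℤ) - 2 := by exact_mod_cast e3
  push_cast at e4
  rcases Nat.eq_or_lt_of_le hin with heq | hlt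
  · -- `i = n`
    have : (n : ℤ) = (i₀ : ℤ) + 1 := by exact_mod_cast heq.symm
    rw [this] at e4
    nlinarith
  · have h0i : (0 : ℤ) ≤ i₀ := by exact_mod_cast Nat.zero_le i₀
    have hni : (0 : ℤ) ≤ (n : ℤ) - (i₀ + 1) - 1 := by
      have : ((i₀ + 1 : ℕ) : ℤ) < n := by exact_mod_cast hlt
      push_cast at this
      linarith
    nlinarith [mul_nonneg h0i hni, mul_nonneg (by linarith : (0 : ℤ) ≤ (i₀ : ℤ) + 1) hni]

end NotInSl2

end Literature.Algebra.Lie
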